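import Summits.ResolutionOfSingularities.ResolutionOfSingularities.Theorems.FrobeniusLadderFInjectiveMacaulayficationFermatCubicConeGerm
import Summits.ResolutionOfSingularities.ResolutionOfSingularities.Theorems.FrobeniusLadderFInjectiveMacaulayficationDoublePointFermatCubicCharts
import HarnessLib

/-!
# INFORMATIVE-STRATUM GERM INSTANCES OF THE F-HALF: the double point `x₀² + x₁³ + ⋯ + x_{m+3}³ = 0 ⊂ 𝔸^{m+4}` in characteristic 2 («FULL model still singular»)
# (crux `FInjectiveMacaulayfication` stmt-ResolutionOfSingularities-15315, chain w45a; res-L1-w45a-stub-1 g9 OFFER (C); FILE 3b = the scheme-level germ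
# instance on top of the chart certificates `…DoublePointFermatCubicCharts` (FILE 3a) and the interface `…GermOfGlobalBlowup` (p599230); seat res-L1-w45a-stub-1 g9)

[OURS · L1 W4.5a] Support file (`--supports stmt-ResolutionOfSingularities-15315 --as helper`); replaces the role of NO printed item; NOT a
statement of the manuscript; def-free, unconditional; a CERTIFICATE, not in the cone of door v36.2's `_proof`. AI-written (AI review is weaker than
expert review).

## What is here
`k` a field of characteristic `2`, `m : ℕ`, `f = X₀² + Σ_{l<m+3} X_{l+1}³`, `X = Spec k[X₀,…,X_{m+3}]/(f)` (dimension `d = m + 3`), `v` its vertex (prime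
`(x̄₀, …, x̄_{m+3})`). An isolated F-DEGENERATE DOUBLE POINT (`f ∈ 𝔪^{[2]}`; res-L1-w45a-idea-1's DP4 class `z² = B`, here `B` = Fermat cubic, `p = 2`).

* `affineBlowup_vertex_fullCl` — the ONE-POINT blow-up `affineBlowup (x̄)` of `X` is FULL at EVERY point (engine `GermOfGlobalBlowup.hypersurfacePointBlowup_fullCl`
  fed with FILE 3a: chart `X₀` misses the exceptional divisor; chart `X_{l+1}` is Jacobian-regular off `h = 0` and FEDDER-F-pure (via a slicing) on `h = 0`).
* ★ `chart_one_singular_point` — **the FULL model is STILL SINGULAR**: the `X₁`-chart `k[X]/(g₁)`, `g₁ = X₀² + X₁(1 + X₂³ + ⋯ + X_{m+3}³)`, has a maximal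
  ideal `Q` ON THE EXCEPTIONAL DIVISOR (`∋ x̄₁`; the point `X₂ = 1`, all other coordinates `0`) at which it is NOT a regular local ring (`g₁(a) = 0`, `∇g₁(a) = 0`).
  This is the census certificate of the INFORMATIVE STRATUM (res-L1-w45a-tri-2 #348 (c)): FULL-ification WITHOUT resolution.
* the five germ-form hypotheses at `v` (`isClosed_vertex`, `vertex_not_mem_regularLocus`, `ringKrullDim_stalk_vertex : dim 𝒪_{X,v} = m + 3`,
  `regular_off_closedPoint_vertex`, `cmCl_Spec_stalk_vertex`), the scheme-level binders (`isIntegral_doublePoint`; `FermatCubicConeGerm.structureMorphism_*`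
  are generic), the conclusion `fInjectivizationGermAt_vertex : GermForm.FInjectivizationGermAt 2 v`, and
* ★★ `doublePointFermatCubic_vertex_germ_instance` — the conjunction: `(X, v)` is a POSITIVE INSTANCE, hypotheses AND conclusion, of the germ form
  `GermForm.LocalFInjectivizationGerm 2 (m + 3)`; for `m ≥ 1` (d ≥ 4) an instance of the registered F-half `LocalFInjectivizationFibreAdmGe4` at `I = ⊤`
  (`GermForm.localFInjectivizationFibreAdmGe4_at_top_iff_germ`) in exact currency, INFORMATIVE STRATUM, one per dimension `d ≥ 4`.
* generic by-products (any hypersurface `f` with `f(0) = 0`): `isMaximal_origin`, `comap_origin`, `exists_origin`, `isClosed_origin`,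
  `cmCl_localization_hypersurface` (every local ring of a hypersurface `k[X]/(f)`, `f ≠ 0`, satisfies the CM-clause).

[folklore mathematics, OURS as a certificate; cite: Fedder1983, Thm. 1.12; Hartshorne1977, I Thm. 5.1; Matsumura1987, Thm. 17.4 and Thm. 17.8;
GortzWedhorn2020, Prop. 13.91 (2)]
-/

-- single-problem summit: the doubled namespace component is forced
set_option linter.dupNamespace false

noncomputable section

open AlgebraicGeometry CategoryTheory Literature.AlgebraicGeometry.Resolution TopologicalSpace IsLocalRing MvPolynomial

namespace Summit.ResolutionOfSingularities.ResolutionOfSingularities.Theorems.FInjectiveMacaulayfication.DoublePointFermatCubicGerm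

open Summit.ResolutionOfSingularities.ResolutionOfSingularities.Theorems.FInjectiveMacaulayfication
open SliceableCentre GermForm GermOfGlobalBlowup DoublePointFermatCubicCharts

/-! ## §0 Generic: the origin of a hypersurface `k[X]/(f)` with `f(0) = 0`; the CM-clause of hypersurface local rings -/

/-- For `f(0) = 0`: `(x̄₀, …, x̄_{n−1})` pulls back to `(X₀, …, X_{n−1})`. [folklore] -/
theorem comap_origin (k : Type) [Field k] {n : ℕ} (f : MvPolynomial (Fin n) k) (h0 : constantCoeff f = 0) :
    (Ideal.span (Set.range fun j : Fin n => Ideal.Quotient.mk (Ideal.span {f}) (X j))).comap (Ideal.Quotient.mk (Ideal.span {f})) =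
      Ideal.span (Set.range (X : Fin n → MvPolynomial (Fin n) k)) := by
  rw [FermatCubicConeGerm.span_range_mk_X_eq_map, Ideal.comap_map_of_surjective _ Ideal.Quotient.mk_surjective, sup_eq_left]
  intro g hg
  rw [Ideal.mem_comap, Ideal.mem_bot, Ideal.Quotient.eq_zero_iff_mem, Ideal.mem_span_singleton] at hg
  obtain ⟨c, rfl⟩ := hg
  refine Ideal.mul_mem_right _ _ ?_
  rw [Fedder.span_range_X_eq_ker, RingHom.mem_ker]
  exact h0

/-- For `f(0) = 0`: **the origin `(x̄₀, …, x̄_{n−1})` is a maximal ideal of `k[X]/(f)`.** [folklore] -/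
theorem isMaximal_origin (k : Type) [Field k] {n : ℕ} (f : MvPolynomial (Fin n) k) (h0 : constantCoeff f = 0) :
    (Ideal.span (Set.range fun j : Fin n => Ideal.Quotient.mk (Ideal.span {f}) (X j))).IsMaximal := by
  rw [FermatCubicConeGerm.span_range_mk_X_eq_map]
  haveI : (Ideal.span (Set.range (X : Fin n → MvPolynomial (Fin n) k))).IsMaximal :=
    QuotientOriginMaximal.idealOfVars_isMaximal k (n := n)
  refine Ideal.IsMaximal.map_of_surjective_of_ker_le Ideal.Quotient.mk_surjective ?_
  rw [Ideal.mk_ker, Ideal.span_singleton_le_iff_mem, Fedder.span_range_X_eq_ker, RingHom.mem_ker]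
  exact h0

/-- For `f(0) = 0`: the origin is a point of `Spec k[X]/(f)`. [folklore] -/
theorem exists_origin (k : Type) [Field k] {n : ℕ} (f : MvPolynomial (Fin n) k) (h0 : constantCoeff f = 0) :
    ∃ v : Spec (.of (MvPolynomial (Fin n) k ⧸ Ideal.span {f})),
      v.asIdeal = Ideal.span (Set.range fun j : Fin n => Ideal.Quotient.mk (Ideal.span {f}) (X j)) :=
  ⟨⟨_, (isMaximal_origin k f h0).isPrime⟩, rfl⟩

/-- For `f(0) = 0`: the origin is a CLOSED point of `Spec k[X]/(f)`. [folklore] -/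
theorem isClosed_origin (k : Type) [Field k] {n : ℕ} (f : MvPolynomial (Fin n) k) (h0 : constantCoeff f = 0)
    (v : Spec (.of (MvPolynomial (Fin n) k ⧸ Ideal.span {f})))
    (hv : v.asIdeal = Ideal.span (Set.range fun j : Fin n => Ideal.Quotient.mk (Ideal.span {f}) (X j))) :
    IsClosed ({v} : Set (Spec (.of (MvPolynomial (Fin n) k ⧸ Ideal.span {f})))) := by
  have h : v.asIdeal.IsMaximal := by
    rw [hv]
    exact isMaximal_origin k f h0
  exact (PrimeSpectrum.isClosed_singleton_iff_isMaximal v).mpr h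

/-- **Every local ring of a hypersurface `k[X]/(f)` (`f ≠ 0`) satisfies the CM-clause** (a hypersurface in the regular local ring `k[X]_P`;
`Fedder.sop_isWeaklyRegular_quotient` transported along `k[X]_P/(f) ≅ (k[X]/(f))_{P/(f)}`). [cite: Matsumura1987, Thm. 17.4 (iii) and Thm. 17.8] -/
theorem cmCl_localization_hypersurface (k : Type) [Field k] {n : ℕ} (f : MvPolynomial (Fin n) k) (hf0 : f ≠ 0)
    (v : Spec (.of (MvPolynomial (Fin n) k ⧸ Ideal.span {f}))) :
    CMCl (Localization.AtPrime v.asIdeal) := by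
  set P : Ideal (MvPolynomial (Fin n) k) := v.asIdeal.comap (Ideal.Quotient.mk (Ideal.span {f})) with hPdef
  haveI : IsRegularLocalRing (Localization.AtPrime P) := IsRegularRing.isRegularLocalRing_localization P
  have hfP : f ∈ P := FermatCubicConeChar2.self_mem_comap f v.asIdeal
  have hinj : Function.Injective (algebraMap (MvPolynomial (Fin n) k) (Localization.AtPrime P)) :=
    IsLocalization.injective (Localization.AtPrime P) P.primeCompl_le_nonZeroDivisors
  have hfm : algebraMap (MvPolynomial (Fin n) k) (Localization.AtPrime P) f ∈ maximalIdeal (Localization.AtPrime P) := by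
    rw [← IsLocalization.AtPrime.map_eq_maximalIdeal P (Localization.AtPrime P)]
    exact Ideal.mem_map_of_mem _ hfP
  have hf0' : algebraMap (MvPolynomial (Fin n) k) (Localization.AtPrime P) f ≠ 0 := fun h =>
    hf0 (hinj (by rw [h, map_zero]))
  have hCM : CMCl (Localization.AtPrime P ⧸ Ideal.span {algebraMap (MvPolynomial (Fin n) k) (Localization.AtPrime P) f}) :=
    fun d hd s hs => Fedder.sop_isWeaklyRegular_quotient hfm hf0' d hd s hs
  obtain ⟨e⟩ := QuotLocalizationIso.stub_quotLocalizationIso (MvPolynomial (Fin n) k) f P v.asIdeal rfl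
  exact cmClause_of_ringEquiv e hCM

/-! ## §1 The one-point blow-up of the double point is FULL at every point -/

/-- `f = X₀² + Σ X_{l+1}³` has no constant term. [folklore] -/
theorem constantCoeff_f (k : Type) [Field k] (m : ℕ) (f : MvPolynomial (Fin (m + 4)) k)
    (hf : f = X 0 ^ 2 + ∑ l : Fin (m + 3), X l.succ ^ 3) : constantCoeff f = 0 := by
  rw [hf, map_add, map_pow, constantCoeff_X, zero_pow two_ne_zero, zero_add, map_sum]
  exact Finset.sum_eq_zero fun l _ => by rw [map_pow, constantCoeff_X, zero_pow three_ne_zero]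

/-- **The ONE-POINT blow-up `affineBlowup (x̄₀, …, x̄_{m+3})` of the double point is FULL at EVERY point** — strict transforms `g₀ = 1 + X₀·Σ X³` (misses the
exceptional divisor) and `g_{l+1} = X₀² + X_{l+1}·(1 + Σ_j X_{(l.succAbove j)+1}³)` (Jacobian off `h = 0`, Fedder-via-slicing on `h = 0`), `μ = 2`.
[folklore mathematics; OURS as a certificate] -/
theorem affineBlowup_vertex_fullCl (k : Type) [Field k] [CharP k 2] (m : ℕ) (f : MvPolynomial (Fin (m + 4)) k)
    (hf : f = X 0 ^ 2 + ∑ l : Fin (m + 3), X l.succ ^ 3) :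
    ∀ y : ↥(affineBlowup (Ideal.span (Set.range fun j : Fin (m + 4) => Ideal.Quotient.mk (Ideal.span {f}) (X j)))),
      FullCl 2 ((affineBlowup (Ideal.span (Set.range fun j : Fin (m + 4) =>
        Ideal.Quotient.mk (Ideal.span {f}) (X j)))).presheaf.stalk y) := by
  haveI : Fact (Nat.Prime 2) := ⟨Nat.prime_two⟩
  have hprime := prime_f k m f hf
  refine hypersurfacePointBlowup_fullCl 2 k (m + 4) (by omega) f
    (fun i => Fin.cases (motive := fun _ => MvPolynomial (Fin (m + 4)) k)
      (1 + X 0 * ∑ l : Fin (m + 3), (X l.succ : MvPolynomial (Fin (m + 4)) k) ^ 3)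
      (fun l => X 0 ^ 2 + X l.succ * (1 + ∑ j : Fin (m + 2), (X (l.succAbove j).succ : MvPolynomial (Fin (m + 4)) k) ^ 3)) i)
    2 ((Ideal.span_singleton_prime hprime.ne_zero).mpr hprime) ?_ (f_not_mem_span_X k m f hf) ?_
    (fun P _ hP => regular_off_vertex k m f hf P hP) ?_
  · intro i
    refine Fin.cases ?_ (fun l => ?_) i
    · exact theta_zero k m f hf
    · exact theta_succ k m f hf l
  · intro i
    refine Fin.cases ?_ (fun l => ?_) i
    · exact g_zero_not_mem_span_X k m
    · exact g_succ_not_mem_span_X k m l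
  · intro i
    refine Fin.cases ?_ (fun l => ?_) i
    · -- the chart `X₀` misses the exceptional divisor (the instance is passed explicitly: its type mentions `Fin.cases … 0`)
      intro Q hQmax hQ
      exact (@chart_zero_vacuous k _ m Q hQmax hQ).elim
    · intro Q hQmax hQ
      exact @chart_succ_clause k _ _ m l _ _ rfl rfl Q hQmax hQ

/-! ## §2 The FULL model is still SINGULAR (census certificate of the informative stratum) -/

/-- ★ **The `X₁`-chart of the blow-up has a SINGULAR closed point on the exceptional divisor.** For `g₁ = X₀² + X₁·h`, `h = 1 + Σ_j X_{j+2}³` (the strict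
transform on the chart `X₁ = X_{0+1}`), the point `a` with `X₂ = X_{(0.succAbove 0)+1} = 1` and all other coordinates `0` lies on `g₁ = 0` (`a₀ = a₁ = 0`),
on the exceptional divisor (`a₁ = 0`), and on `h = 0` (`h(a) = 1 + 1 = 0` in characteristic 2); there `∇g₁(a) = 0`
(`∂₀ g₁ = 2X₀`, `∂₁ g₁ = h`, `∂ᵢ g₁ = X₁ ∂ᵢ h` otherwise), so the local ring is NOT regular (Jacobian criterion, singular direction). Hence the FULL model
`affineBlowup (x̄)` of `affineBlowup_vertex_fullCl` is NOT a resolution. [cite: Hartshorne1977, I Thm. 5.1; Matsumura1987, Thm. 14.2] -/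
theorem chart_one_singular_point (k : Type) [Field k] [CharP k 2] (m : ℕ) :
    ∃ (Q : Ideal (MvPolynomial (Fin (m + 4)) k ⧸ Ideal.span
        {(X 0 ^ 2 + X (0 : Fin (m + 3)).succ * (1 + ∑ j : Fin (m + 2),
          (X (((0 : Fin (m + 3)).succAbove j).succ) : MvPolynomial (Fin (m + 4)) k) ^ 3))})) (_ : Q.IsMaximal),
      Ideal.Quotient.mk _ (X (0 : Fin (m + 3)).succ) ∈ Q ∧ ¬ IsRegularLocalRing (Localization.AtPrime Q) := by
  classical
  set h : MvPolynomial (Fin (m + 4)) k :=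
    1 + ∑ j : Fin (m + 2), (X (((0 : Fin (m + 3)).succAbove j).succ) : MvPolynomial (Fin (m + 4)) k) ^ 3 with hh
  set g : MvPolynomial (Fin (m + 4)) k := X 0 ^ 2 + X (0 : Fin (m + 3)).succ * h with hg
  -- the point `a`: the coordinate `X_{(0.succAbove 0)+1}` is `1`, all others `0`
  set a : Fin (m + 4) → k := Pi.single (((0 : Fin (m + 3)).succAbove 0).succ) 1 with ha
  have ha0 : a 0 = 0 := by rw [ha]; exact Pi.single_eq_of_ne (Fin.succ_ne_zero _).symm _
  have ha1 : a (0 : Fin (m + 3)).succ = 0 := by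
    rw [ha]
    exact Pi.single_eq_of_ne (fun e => Fin.succAbove_ne 0 0 (Fin.succ_injective _ e).symm) _
  have h2 : (2 : k) = 0 := by simpa using CharP.cast_eq_zero k 2
  have hha : MvPolynomial.eval a h = 0 := by
    have hne : ∀ j : Fin (m + 1),
        Pi.single (M := fun _ : Fin (m + 4) => k) (((0 : Fin (m + 3)).succAbove 0).succ) (1 : k) (((0 : Fin (m + 3)).succAbove j.succ).succ) = 0 :=
      fun j => Pi.single_eq_of_ne (fun e => Fin.succ_ne_zero j (Fin.succAbove_right_injective (Fin.succ_injective _ e))) _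
    rw [hh, map_add, map_one, map_sum, Fin.sum_univ_succ]
    simp only [map_pow, eval_X, ha, Pi.single_eq_same, one_pow, hne, zero_pow three_ne_zero, Finset.sum_const_zero, add_zero]
    rw [show (1 : k) + 1 = 2 by norm_num, h2]
  have hga : MvPolynomial.eval a g = 0 := by
    rw [hg, map_add, map_pow, eval_X, ha0, zero_pow two_ne_zero, zero_add, map_mul, eval_X, ha1, zero_mul]
  have hg0 : g ≠ 0 := fun h0 => g_succ_not_mem_span_X k m 0 (by rw [← hh, ← hg, h0]; exact Ideal.zero_mem _)
  -- the gradient vanishes at `a`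
  have hgrad : ∀ i : Fin (m + 4), MvPolynomial.eval a (pderiv i g) = 0 := by
    intro i
    have hlin : pderiv i g = 2 * X 0 * pderiv i (X 0) + (pderiv i (X (0 : Fin (m + 3)).succ) * h +
        X (0 : Fin (m + 3)).succ * pderiv i h) := by
      rw [hg, map_add, pderiv_pow, Derivation.leibniz, smul_eq_mul, smul_eq_mul]
      push_cast
      ring
    rw [hlin]
    simp only [map_add, map_mul, eval_X, ha0, hha, ha1, mul_zero, zero_mul, zero_add]
  -- the maximal ideal of `a` on `k[X]/(g)`
  have hgker : g ∈ RingHom.ker (MvPolynomial.eval a) := hga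
  haveI hKmax : (RingHom.ker (MvPolynomial.eval a)).IsMaximal :=
    RingHom.ker_isMaximal_of_surjective _ fun c => ⟨C c, eval_C c⟩
  have hQmax : ((RingHom.ker (MvPolynomial.eval a)).map (Ideal.Quotient.mk (Ideal.span {g}))).IsMaximal :=
    Ideal.IsMaximal.map_of_surjective_of_ker_le Ideal.Quotient.mk_surjective
      (by rw [Ideal.mk_ker, Ideal.span_singleton_le_iff_mem]; exact hgker)
  refine ⟨(RingHom.ker (MvPolynomial.eval a)).map (Ideal.Quotient.mk (Ideal.span {g})), hQmax, ?_, ?_⟩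
  · exact Ideal.mem_map_of_mem _ (show (X (0 : Fin (m + 3)).succ : MvPolynomial (Fin (m + 4)) k) ∈ RingHom.ker (MvPolynomial.eval a) by
      rw [RingHom.mem_ker, eval_X, ha1])
  · haveI : ((RingHom.ker (MvPolynomial.eval a)).map (Ideal.Quotient.mk (Ideal.span {g}))).IsPrime := hQmax.isPrime
    refine not_isRegularLocalRing_localization_of_pderiv_eval_eq_zero a hg0 hga hgrad _ ?_
    rw [Ideal.comap_map_of_surjective _ Ideal.Quotient.mk_surjective, sup_eq_left]
    intro q hq
    rw [Ideal.mem_comap, Ideal.mem_bot, Ideal.Quotient.eq_zero_iff_mem, Ideal.mem_span_singleton] at hq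
    obtain ⟨c, rfl⟩ := hq
    exact Ideal.mul_mem_right _ _ hgker

/-! ## §3 The five hypotheses of the germ form at the vertex -/

/-- (H1) The vertex is a closed point. [folklore] -/
theorem isClosed_vertex (k : Type) [Field k] (m : ℕ) (f : MvPolynomial (Fin (m + 4)) k)
    (hf : f = X 0 ^ 2 + ∑ l : Fin (m + 3), X l.succ ^ 3)
    (v : Spec (.of (MvPolynomial (Fin (m + 4)) k ⧸ Ideal.span {f})))
    (hv : v.asIdeal = Ideal.span (Set.range fun j : Fin (m + 4) => Ideal.Quotient.mk (Ideal.span {f}) (X j))) :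
    IsClosed ({v} : Set (Spec (.of (MvPolynomial (Fin (m + 4)) k ⧸ Ideal.span {f})))) :=
  isClosed_origin k f (constantCoeff_f k m f hf) v hv

/-- (H2) **The vertex is NOT a regular point**: `f(0) = 0`, `∇f(0) = 0` (`∂₀f = 2X₀`, `∂_{l+1}f = 3X_{l+1}²`). [cite: Hartshorne1977, I Thm. 5.1] -/
theorem vertex_not_mem_regularLocus (k : Type) [Field k] [CharP k 2] (m : ℕ) (f : MvPolynomial (Fin (m + 4)) k)
    (hf : f = X 0 ^ 2 + ∑ l : Fin (m + 3), X l.succ ^ 3)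
    (v : Spec (.of (MvPolynomial (Fin (m + 4)) k ⧸ Ideal.span {f})))
    (hv : v.asIdeal = Ideal.span (Set.range fun j : Fin (m + 4) => Ideal.Quotient.mk (Ideal.span {f}) (X j))) :
    v ∉ Scheme.regularLocus (Spec (.of (MvPolynomial (Fin (m + 4)) k ⧸ Ideal.span {f}))) := by
  classical
  refine not_mem_regularLocus_Spec_of_not_isRegularLocalRing v ?_
  refine not_isRegularLocalRing_localization_of_pderiv_eval_eq_zero (0 : Fin (m + 4) → k) (prime_f k m f hf).ne_zero ?_ ?_ v.asIdeal ?_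
  · rw [MvPolynomial.eval_zero]
    exact constantCoeff_f k m f hf
  · intro i
    refine Fin.cases ?_ (fun l => ?_) i
    · rw [pderiv_zero_f k m f hf, map_mul, MvPolynomial.eval_X, Pi.zero_apply, mul_zero]
    · rw [pderiv_succ_f k m f hf l, map_mul, map_pow, MvPolynomial.eval_X, Pi.zero_apply, zero_pow two_ne_zero, mul_zero]
  · rw [hv, comap_origin k f (constantCoeff_f k m f hf), MvPolynomial.eval_zero, Fedder.span_range_X_eq_ker]

/-- (H3) **`dim 𝒪_{X,v} = m + 3`** (hypersurface in `𝔸^{m+4}`, closed point). [cite: Matsumura1987, §5 Ex. 5.1 and Thm. 13.5] -/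
theorem ringKrullDim_stalk_vertex (k : Type) [Field k] [CharP k 2] (m : ℕ) (f : MvPolynomial (Fin (m + 4)) k)
    (hf : f = X 0 ^ 2 + ∑ l : Fin (m + 3), X l.succ ^ 3)
    (v : Spec (.of (MvPolynomial (Fin (m + 4)) k ⧸ Ideal.span {f})))
    (hv : v.asIdeal = Ideal.span (Set.range fun j : Fin (m + 4) => Ideal.Quotient.mk (Ideal.span {f}) (X j))) :
    ringKrullDim ((Spec (.of (MvPolynomial (Fin (m + 4)) k ⧸ Ideal.span {f}))).presheaf.stalk v) = (m + 3 : ℕ) := by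
  haveI : v.asIdeal.IsMaximal := by
    rw [hv]
    exact isMaximal_origin k f (constantCoeff_f k m f hf)
  rw [ringKrullDim_stalk_Spec_eq]
  exact HypersurfaceLocalDim.stub_hypersurfaceLocalDim k (m + 3) f (prime_f k m f hf).ne_zero v.asIdeal

/-- **`X` is regular at every point other than the vertex** (in particular at every proper generization). [cite: Hartshorne1977, I Thm. 5.1] -/
theorem regular_of_ne_vertex (k : Type) [Field k] [CharP k 2] (m : ℕ) (f : MvPolynomial (Fin (m + 4)) k)
    (hf : f = X 0 ^ 2 + ∑ l : Fin (m + 3), X l.succ ^ 3)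
    (v : Spec (.of (MvPolynomial (Fin (m + 4)) k ⧸ Ideal.span {f})))
    (hv : v.asIdeal = Ideal.span (Set.range fun j : Fin (m + 4) => Ideal.Quotient.mk (Ideal.span {f}) (X j))) :
    ∀ y : Spec (.of (MvPolynomial (Fin (m + 4)) k ⧸ Ideal.span {f})), y ⤳ v → y ≠ v →
      y ∈ Scheme.regularLocus (Spec (.of (MvPolynomial (Fin (m + 4)) k ⧸ Ideal.span {f}))) := by
  intro y hy hne
  refine FermatCubicConeGerm.mem_regularLocus_Spec_of_isRegularLocalRing y (regular_off_vertex k m f hf y.asIdeal fun hle => hne ?_)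
  have h2 : y.asIdeal ≤ v.asIdeal := (PrimeSpectrum.le_iff_specializes y v).mpr hy
  exact PrimeSpectrum.ext (le_antisymm h2 (hv ▸ hle))

/-- (H4) **ISOLATED: `Spec 𝒪_{X,v}` is regular off its closed point.** [cite: Hartshorne1977, I Thm. 5.1; Temkin2008, §2.1] -/
theorem regular_off_closedPoint_vertex (k : Type) [Field k] [CharP k 2] (m : ℕ) (f : MvPolynomial (Fin (m + 4)) k)
    (hf : f = X 0 ^ 2 + ∑ l : Fin (m + 3), X l.succ ^ 3)
    (v : Spec (.of (MvPolynomial (Fin (m + 4)) k ⧸ Ideal.span {f})))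
    (hv : v.asIdeal = Ideal.span (Set.range fun j : Fin (m + 4) => Ideal.Quotient.mk (Ideal.span {f}) (X j))) :
    ∀ s : Spec ((Spec (.of (MvPolynomial (Fin (m + 4)) k ⧸ Ideal.span {f}))).presheaf.stalk v),
      s ≠ closedPoint _ → s ∈ Scheme.regularLocus (Spec ((Spec (.of (MvPolynomial (Fin (m + 4)) k ⧸ Ideal.span {f}))).presheaf.stalk v)) :=
  regularLocus_Spec_stalk_of_isolated v (regular_of_ne_vertex k m f hf v hv)

/-- (H5) **The CM-clause at every point of `Spec 𝒪_{X,v}`.** [cite: Matsumura1987, Thm. 17.4 and Thm. 17.8] -/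
theorem cmCl_Spec_stalk_vertex (k : Type) [Field k] [CharP k 2] (m : ℕ) (f : MvPolynomial (Fin (m + 4)) k)
    (hf : f = X 0 ^ 2 + ∑ l : Fin (m + 3), X l.succ ^ 3)
    (v : Spec (.of (MvPolynomial (Fin (m + 4)) k ⧸ Ideal.span {f})))
    (hv : v.asIdeal = Ideal.span (Set.range fun j : Fin (m + 4) => Ideal.Quotient.mk (Ideal.span {f}) (X j))) :
    ∀ s : Spec ((Spec (.of (MvPolynomial (Fin (m + 4)) k ⧸ Ideal.span {f}))).presheaf.stalk v),
      CMCl ((Spec ((Spec (.of (MvPolynomial (Fin (m + 4)) k ⧸ Ideal.span {f}))).presheaf.stalk v)).presheaf.stalk s) :=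
  cmCl_Spec_stalk_of_isolated v (cmCl_stalk_Spec_of_cmCl_localization v (cmCl_localization_hypersurface k f (prime_f k m f hf).ne_zero v))
    (regular_of_ne_vertex k m f hf v hv)

/-- `X` is an integral scheme. [folklore] -/
theorem isIntegral_doublePoint (k : Type) [Field k] [CharP k 2] (m : ℕ) (f : MvPolynomial (Fin (m + 4)) k)
    (hf : f = X 0 ^ 2 + ∑ l : Fin (m + 3), X l.succ ^ 3) :
    IsIntegral (Spec (.of (MvPolynomial (Fin (m + 4)) k ⧸ Ideal.span {f}))) := by
  haveI := (Ideal.span_singleton_prime (prime_f k m f hf).ne_zero).mpr (prime_f k m f hf)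
  haveI : IsDomain (MvPolynomial (Fin (m + 4)) k ⧸ Ideal.span {f}) := Ideal.Quotient.isDomain _
  infer_instance

/-! ## §4 The conclusion at the vertex and the instance -/

/-- ★ **`GermForm.FInjectivizationGermAt 2 v` at the vertex of the double point** — through `GermOfGlobalBlowup.fInjectivizationGermAt_origin_of_hypersurfacePointBlowup`
with the certificates of FILE 3a; INFORMATIVE STRATUM (the FULL model is singular, `chart_one_singular_point`). [folklore mathematics; OURS as a certificate] -/
theorem fInjectivizationGermAt_vertex (k : Type) [Field k] [CharP k 2] (m : ℕ) (f : MvPolynomial (Fin (m + 4)) k)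
    (hf : f = X 0 ^ 2 + ∑ l : Fin (m + 3), X l.succ ^ 3)
    (v : Spec (.of (MvPolynomial (Fin (m + 4)) k ⧸ Ideal.span {f})))
    (hv : v.asIdeal = Ideal.span (Set.range fun j : Fin (m + 4) => Ideal.Quotient.mk (Ideal.span {f}) (X j))) :
    FInjectivizationGermAt 2 v := by
  haveI : Fact (Nat.Prime 2) := ⟨Nat.prime_two⟩
  haveI := (Ideal.span_singleton_prime (prime_f k m f hf).ne_zero).mpr (prime_f k m f hf)
  haveI : IsDomain (MvPolynomial (Fin (m + 4)) k ⧸ Ideal.span {f}) := Ideal.Quotient.isDomain _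
  have hXf : (X 0 : MvPolynomial (Fin (m + 4)) k) ∉ Ideal.span {f} :=
    PrimeTransfer.X_not_mem_span_of_isPrime inferInstance (f_not_mem_span_X k m f hf 0)
  have hI : Ideal.span (Set.range fun j : Fin (m + 4) => Ideal.Quotient.mk (Ideal.span {f}) (X j)) ≠ ⊥ := fun hbot =>
    hXf (Ideal.Quotient.eq_zero_iff_mem.mp
      ((Ideal.mem_bot).mp (hbot ▸ Ideal.subset_span (Set.mem_range_self (0 : Fin (m + 4))))))
  exact fInjectivizationGermAt_of_affineBlowup 2 _ hI v (hv ▸ Ideal.le_radical) (affineBlowup_vertex_fullCl k m f hf)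

/-- ★★ **THE VERTEX OF THE DOUBLE POINT `x₀² + x₁³ + ⋯ + x_{m+3}³ = 0` (characteristic 2) IS A POSITIVE INSTANCE OF THE F-HALF'S GERM FORM — INFORMATIVE
STRATUM.** ALL FIVE point-hypotheses of `GermForm.LocalFInjectivizationGerm 2 (m + 3)` hold at `(X, v)` — `v` closed, `v ∉ Reg X`, `dim 𝒪_{X,v} = m + 3`,
`Spec 𝒪_{X,v}` regular off its closed point, CM-clause at every point of `Spec 𝒪_{X,v}` — AND the conclusion `FInjectivizationGermAt 2 v` holds (scheme-level
binders: `isIntegral_doublePoint`, `FermatCubicConeGerm.structureMorphism_isSeparated` / `…_locallyOfFiniteType` / `…_quasiCompact`). For `m ≥ 1` this is a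
kernel-certified positive instance of the registered F-half `LocalFInjectivizationFibreAdmGe4` at `I = ⊤`, level `d = m + 3 ≥ 4`, in exact currency
(`GermForm.localFInjectivizationFibreAdmGe4_at_top_iff_germ`). CENSUS LABEL: **INFORMATIVE STRATUM «FULL model still singular»** (`chart_one_singular_point`;
res-L1-w45a-tri-2 #348 (c)) — FULL-ification by ONE point blow-up WITHOUT resolving. [folklore mathematics; OURS as a certificate] -/
theorem doublePointFermatCubic_vertex_germ_instance (k : Type) [Field k] [CharP k 2] (m : ℕ) (f : MvPolynomial (Fin (m + 4)) k)
    (hf : f = X 0 ^ 2 + ∑ l : Fin (m + 3), X l.succ ^ 3)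
    (v : Spec (.of (MvPolynomial (Fin (m + 4)) k ⧸ Ideal.span {f})))
    (hv : v.asIdeal = Ideal.span (Set.range fun j : Fin (m + 4) => Ideal.Quotient.mk (Ideal.span {f}) (X j))) :
    IsClosed ({v} : Set (Spec (.of (MvPolynomial (Fin (m + 4)) k ⧸ Ideal.span {f})))) ∧
    v ∉ Scheme.regularLocus (Spec (.of (MvPolynomial (Fin (m + 4)) k ⧸ Ideal.span {f}))) ∧
    ringKrullDim ((Spec (.of (MvPolynomial (Fin (m + 4)) k ⧸ Ideal.span {f}))).presheaf.stalk v) = (m + 3 : ℕ) ∧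
    (∀ s : Spec ((Spec (.of (MvPolynomial (Fin (m + 4)) k ⧸ Ideal.span {f}))).presheaf.stalk v), s ≠ closedPoint _ →
      s ∈ Scheme.regularLocus (Spec ((Spec (.of (MvPolynomial (Fin (m + 4)) k ⧸ Ideal.span {f}))).presheaf.stalk v))) ∧
    (∀ s : Spec ((Spec (.of (MvPolynomial (Fin (m + 4)) k ⧸ Ideal.span {f}))).presheaf.stalk v),
      CMCl ((Spec ((Spec (.of (MvPolynomial (Fin (m + 4)) k ⧸ Ideal.span {f}))).presheaf.stalk v)).presheaf.stalk s)) ∧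
    FInjectivizationGermAt 2 v :=
  ⟨isClosed_vertex k m f hf v hv, vertex_not_mem_regularLocus k m f hf v hv, ringKrullDim_stalk_vertex k m f hf v hv,
    regular_off_closedPoint_vertex k m f hf v hv, cmCl_Spec_stalk_vertex k m f hf v hv, fInjectivizationGermAt_vertex k m f hf v hv⟩

end Summit.ResolutionOfSingularities.ResolutionOfSingularities.Theorems.FInjectiveMacaulayfication.DoublePointFermatCubicGerm

end
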